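import Summits.HubbardSuperconductivity.HubbardSuperconductivity.Theorems.BalabanIRBirGroundStateAverageLROSoftminPeierls
import Summits.HubbardSuperconductivity.HubbardSuperconductivity.Theorems.BalabanIRBirGroundStateAverageLROSectorCompression
import Literature.MathematicalPhysics.QuantumLattice.FinDimSpectrumSectorGibbsLimit
import Literature.MathematicalPhysics.QuantumLattice.BdGBondHamiltonianParticleHole
import Literature.Computability.AlgebraicComplexity.SubspaceProjection
import Summits.HubbardSuperconductivity.HubbardSuperconductivity.Theorems.BalabanIRBirGroundStateAverageLRO
import Summits.HubbardSuperconductivity.HubbardSuperconductivity.Theorems.BalabanIRBirGappedPhaseReductionThermal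
import Summits.HubbardSuperconductivity.HubbardSuperconductivity.Theorems.BalabanIRBirGroundStateAverageLROStubSectorProjCommutePair
import Summits.HubbardSuperconductivity.HubbardSuperconductivity.Theorems.BalabanIRBirGroundStateAverageLROSoftminTransfer

/-!
# Route BalabanIR — crux `BirGroundStateAverageLRO` (item `stmt-HubbardSuperconductivity-2079`), line `Sketch` (softmin-pair-penalty): the entropy-dial transfer (R2, isotropic schedule `β_L = θL`)

* `sector_peierls_bogoliubov` — for an invariant subspace `K ≠ ⊥` of two Hermitian matrices `X`, `W`
  and `P = P_K`: `Re tr(P e^{-βX}) · exp(-β ⟨W⟩^K_{β,X}) ≤ Re tr(P e^{-β(X+W)})`, the tree's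
  `Matrix.peierls_bogoliubov` transported to the sector through an orthonormal frame
  (`frame_conjTranspose_gibbsWeight_mul`, file `…SectorCompression`).
* `softmin_chain_entropic` — the lever (★) of card softmin-pair-penalty with the ENTROPY DIAL: for a
  unit eigenvector `ψ ∈ K` of `H` (`Hψ = eψ`), `A` Hermitian leaving `K` invariant, `β, g > 0`, the
  thermal floor `m · Re tr(P e^{-β(H+gA)}) ≤ Re tr(P e^{-β(H+gA)} A)` and the state count
  `log Re tr(P e^{-β(H - e)}) ≤ σ`:  `g·m - σ/β ≤ g · Re⟨ψ, Aψ⟩`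
  (Peierls for the vector state, `softmin_le_expect`, then `F(H₀+B) - F(H₀) ≥ ⟨B⟩_{H₀+B}` from
  `sector_peierls_bogoliubov` with base `H₀ + B` and perturbation `-B`).
* `everyGroundState_of_isotropicFloorAt`, `stub_transferIsotropic` (= `transfer_isotropic`) — on the
  Hubbard torus: the penalised thermal floor `⟨Δ_d†Δ_d⟩^S_{β_L,K} ≥ x L⁴` at the ISOTROPIC inverse
  temperature `β_L = θL` together with the state count `log Re tr(P_S e^{-β_L(H - e_S)}) ≤ C·L/θ`
  and `4C ≤ θ²κx` give `Re⟨ψ, Δ_d†Δ_d ψ⟩ ≥ (x/2)L⁴` for every sector ground state, hence the crux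
  (`birGroundStateAverageLRO_of_forall_groundState`). This is the second socket (R2) of line
  `Sketch`; R1 (`β_L = θL²`, no state count) is `…SoftminTransfer`.

Sources: Peierls–Bogoliubov inequality, B. Simon, *The Statistical Mechanics of Lattice Gases* I
(1993) Thm. I.8.6; H. Tasaki (2020) App. A. Folklore; no definition is introduced.
-/

noncomputable section

namespace Summit.HubbardSuperconductivity.HubbardSuperconductivity.Theorems.BirGroundStateAverageLRO.Softmin

open Matrix Finset Literature.MathematicalPhysics.QuantumLattice Literature.Probability.LatticeModels
open Literature.Computability.AlgebraicComplexity
open Summit.HubbardSuperconductivity.HubbardSuperconductivity.Theses.BalabanIR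
open Summit.HubbardSuperconductivity.HubbardSuperconductivity.Theorems
open scoped ComplexOrder

section Abstract

variable {n : Type*} [Fintype n] [DecidableEq n]

/-- **Peierls–Bogoliubov in a sector.** `K ≠ ⊥` a subspace invariant under the Hermitian `X` and
`W`, `P = P_K` its orthogonal projection: `Re tr(P e^{-βX}) · exp(-β · Re tr(P e^{-βX} W)/Re tr(P e^{-βX}))
≤ Re tr(P e^{-β(X+W)})`. Proved by orthonormal-frame compression to the tree's whole-space
`Matrix.peierls_bogoliubov`; after the reparametrisation `X = H + κY`, `W = -κY` it is the same
inequality as `Theorems.sectorPartitionFn_mul_exp_le` (crux 5, proved there by an eigenbasis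
computation). [folklore] -/
theorem sector_peierls_bogoliubov (K : Submodule ℂ (n → ℂ)) (hK : K ≠ ⊥) {X W : Matrix n n ℂ}
    (hX : X.IsHermitian) (hW : W.IsHermitian) (hKX : ∀ v ∈ K, X *ᵥ v ∈ K)
    (hKW : ∀ v ∈ K, W *ᵥ v ∈ K) (β : ℝ) :
    (projMatrix (K.map ((WithLp.linearEquiv 2 ℂ (n → ℂ)).symm :
        (n → ℂ) →ₗ[ℂ] EuclideanSpace ℂ n)) * gibbsWeight β X).trace.re *
        Real.exp (-(β *
          ((projMatrix (K.map ((WithLp.linearEquiv 2 ℂ (n → ℂ)).symm :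
              (n → ℂ) →ₗ[ℂ] EuclideanSpace ℂ n)) * gibbsWeight β X * W).trace.re /
            (projMatrix (K.map ((WithLp.linearEquiv 2 ℂ (n → ℂ)).symm :
              (n → ℂ) →ₗ[ℂ] EuclideanSpace ℂ n)) * gibbsWeight β X).trace.re))) ≤
      (projMatrix (K.map ((WithLp.linearEquiv 2 ℂ (n → ℂ)).symm :
        (n → ℂ) →ₗ[ℂ] EuclideanSpace ℂ n)) * gibbsWeight β (X + W)).trace.re := by
  set P := projMatrix (K.map ((WithLp.linearEquiv 2 ℂ (n → ℂ)).symm :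
    (n → ℂ) →ₗ[ℂ] EuclideanSpace ℂ n)) with hPdef
  obtain ⟨k, B, hk, hBB, hcol, hfix⟩ := exists_orthonormalFrame K
  have hP : P = B * Bᴴ :=
    proj_unique (projMatrix_isHermitian _) (Matrix.isHermitian_mul_conjTranspose_self B)
      (fun _ hw => projMatrix_map_mulVec_of_mem K hw) (projMatrix_map_mulVec_mem K) hfix
      (frame_proj_mulVec_mem hcol)
  have hPX : Commute (B * Bᴴ) X := by
    rw [← hP]; exact projMatrix_map_commute_of_invariant hX K hKX
  have hPW : Commute (B * Bᴴ) W := by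
    rw [← hP]; exact projMatrix_map_commute_of_invariant hW K hKW
  have hPXW : Commute (B * Bᴴ) (X + W) := hPX.add_right hPW
  have hkpos : 0 < k := by rw [hk]; exact Submodule.one_le_finrank_iff.mpr hK
  haveI : Nonempty (Fin k) := ⟨⟨0, hkpos⟩⟩
  set Xt : Matrix (Fin k) (Fin k) ℂ := Bᴴ * X * B with hXt
  set Wt : Matrix (Fin k) (Fin k) ℂ := Bᴴ * W * B with hWt
  have hXt' : Xt.IsHermitian := isHermitian_compress B hX
  have hWt' : Wt.IsHermitian := isHermitian_compress B hW
  have hpb := Matrix.peierls_bogoliubov hXt' hWt' β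
  -- dictionary: compressed quantities = sector quantities
  have h1 : partitionFn β Xt = (P * gibbsWeight β X).trace := by
    rw [hP]; exact (sector_trace_gibbsWeight_eq hBB hX hPX β).symm
  have h2 : (gibbsWeight β Xt * Wt).trace = (P * gibbsWeight β X * W).trace := by
    rw [hP]; exact (sector_trace_gibbsWeight_mul_eq hBB hX hPX β W).symm
  have h3 : Xt + Wt = Bᴴ * (X + W) * B := by
    rw [hXt, hWt, Matrix.mul_add, Matrix.add_mul]
  have h4 : partitionFn β (Xt + Wt) = (P * gibbsWeight β (X + W)).trace := by
    rw [h3, hP]; exact (sector_trace_gibbsWeight_eq hBB (hX.add hW) hPXW β).symm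
  -- the sector partition function is real
  have hZre : (P * gibbsWeight β X).trace =
      (((P * gibbsWeight β X).trace.re : ℝ) : ℂ) := by
    rw [← h1, hXt'.partitionFn_eq_ofReal, Complex.ofReal_re]
  have hgs : (gibbsState β Xt Wt).re =
      (P * gibbsWeight β X * W).trace.re / (P * gibbsWeight β X).trace.re := by
    rw [gibbsState_apply, h1, h2]
    conv_lhs => rw [hZre, ← Complex.ofReal_inv, Complex.re_ofReal_mul]
    rw [div_eq_inv_mul]
  rw [h1, h4, hgs] at hpb
  exact hpb

/-- **The entropy-priced softmin chain** (lever (★) of card softmin-pair-penalty with the entropy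
dial). `K ≠ ⊥` a subspace invariant under the Hermitian `H` and `A`, `P = P_K`; `ψ ∈ K` a unit
vector with `Hψ = eψ`; `β > 0`, `g ≥ 0`; THERMAL FLOOR `m · Re tr(P e^{-β(H + gA)}) ≤
Re tr(P e^{-β(H + gA)} A)` and STATE COUNT `log Re tr(P e^{-β(H - e·1)}) ≤ σ`. Then
`g·m - σ/β ≤ g · Re⟨ψ, Aψ⟩`. (No minimality of `e` is needed.) [folklore] -/
theorem softmin_chain_entropic (K : Submodule ℂ (n → ℂ)) (hK : K ≠ ⊥) {H A : Matrix n n ℂ}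
    (hH : H.IsHermitian) (hA : A.IsHermitian) (hKH : ∀ v ∈ K, H *ᵥ v ∈ K)
    (hKA : ∀ v ∈ K, A *ᵥ v ∈ K) {β g : ℝ} (hβ : 0 < β) (hg : 0 ≤ g) (m e σ : ℝ)
    (ψ : n → ℂ) (hψK : ψ ∈ K) (hψ : star ψ ⬝ᵥ ψ = 1) (hHψ : H *ᵥ ψ = ((e : ℝ) : ℂ) • ψ)
    (hfloor : m * (projMatrix (K.map ((WithLp.linearEquiv 2 ℂ (n → ℂ)).symm :
        (n → ℂ) →ₗ[ℂ] EuclideanSpace ℂ n)) * gibbsWeight β (H + ((g : ℝ) : ℂ) • A)).trace.re ≤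
      (projMatrix (K.map ((WithLp.linearEquiv 2 ℂ (n → ℂ)).symm :
        (n → ℂ) →ₗ[ℂ] EuclideanSpace ℂ n)) * gibbsWeight β (H + ((g : ℝ) : ℂ) • A) * A).trace.re)
    (hσ : Real.log ((projMatrix (K.map ((WithLp.linearEquiv 2 ℂ (n → ℂ)).symm :
        (n → ℂ) →ₗ[ℂ] EuclideanSpace ℂ n)) *
          gibbsWeight β (H - ((e : ℝ) : ℂ) • (1 : Matrix n n ℂ))).trace.re) ≤ σ) :
    g * m - σ / β ≤ g * (star ψ ⬝ᵥ (A *ᵥ ψ)).re := by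
  set P := projMatrix (K.map ((WithLp.linearEquiv 2 ℂ (n → ℂ)).symm :
    (n → ℂ) →ₗ[ℂ] EuclideanSpace ℂ n)) with hPdef
  -- notation
  set B : Matrix n n ℂ := ((g : ℝ) : ℂ) • A with hBdef
  set Kp : Matrix n n ℂ := H + B with hKpdef
  set K' : Matrix n n ℂ := H - ((e : ℝ) : ℂ) • (1 : Matrix n n ℂ) + B with hK'def
  set H₀ : Matrix n n ℂ := H - ((e : ℝ) : ℂ) • (1 : Matrix n n ℂ) with hH₀def
  have hB : B.IsHermitian := by
    rw [hBdef]
    unfold Matrix.IsHermitian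
    rw [conjTranspose_smul, hA.eq, Complex.star_def, Complex.conj_ofReal]
  have h1h : (((e : ℝ) : ℂ) • (1 : Matrix n n ℂ)).IsHermitian := by
    unfold Matrix.IsHermitian
    rw [conjTranspose_smul, conjTranspose_one, Complex.star_def, Complex.conj_ofReal]
  have hH₀ : H₀.IsHermitian := hH.sub h1h
  have hK' : K'.IsHermitian := by rw [hK'def]; exact (hH.sub h1h).add hB
  have hKB : ∀ v ∈ K, B *ᵥ v ∈ K := fun v hv => by
    rw [hBdef, smul_mulVec]; exact K.smul_mem _ (hKA v hv)
  have hKH₀ : ∀ v ∈ K, H₀ *ᵥ v ∈ K := fun v hv => by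
    rw [hH₀def, sub_mulVec, smul_mulVec, one_mulVec]
    exact K.sub_mem (hKH v hv) (K.smul_mem _ hv)
  have hKK' : ∀ v ∈ K, K' *ᵥ v ∈ K := fun v hv => by
    rw [hK'def, add_mulVec]; exact K.add_mem (hKH₀ v hv) (hKB v hv)
  have hKnB : ∀ v ∈ K, (-B) *ᵥ v ∈ K := fun v hv => by
    rw [neg_mulVec]; exact K.neg_mem (hKB v hv)
  -- projection facts
  have hPh : P.IsHermitian := projMatrix_isHermitian _
  have hPP : P * P = P := projMatrix_mul_self _
  have hPH : Commute P H := projMatrix_map_commute_of_invariant hH K hKH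
  have hPA : Commute P A := projMatrix_map_commute_of_invariant hA K hKA
  have hPB : Commute P B := hPA.smul_right _
  have hPK' : Commute P K' := projMatrix_map_commute_of_invariant hK' K hKK'
  have hPψ : P *ᵥ ψ = ψ := projMatrix_map_mulVec_of_mem K hψK
  -- (1) Peierls for the vector state
  have hsoft := softmin_le_expect hPP hPh hPH hPB hH hB hβ e ψ hPψ hψ hHψ
  rw [← hK'def] at hsoft
  have hBψ : (star ψ ⬝ᵥ (B *ᵥ ψ)).re = g * (star ψ ⬝ᵥ (A *ᵥ ψ)).re := by
    rw [hBdef, smul_mulVec, dotProduct_smul, smul_eq_mul, Complex.re_ofReal_mul]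
  rw [hBψ] at hsoft
  set Z' : ℝ := (P * gibbsWeight β K').trace.re with hZ'def
  have hZ'pos : 0 < Z' := sectorZ_pos_of_mem hPP hPh hPK' hK' β ψ hPψ hψ
  -- (2) Peierls–Bogoliubov in the sector with base `K'` and perturbation `-B`
  have hpb := sector_peierls_bogoliubov K hK hK' hB.neg hKK' hKnB β
  rw [← hPdef, ← hZ'def] at hpb
  have hK'B : K' + -B = H₀ := by rw [hK'def, hH₀def]; abel
  rw [hK'B] at hpb
  -- the exponent: `Re tr(P e^{-βK'} (-B)) / Z' = -g · Re tr(P e^{-βK'} A)/Z'`, and the floor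
  have hshift : gibbsWeight β K' = ((Real.exp (β * e) : ℝ) : ℂ) • gibbsWeight β Kp := by
    have : K' = Kp - ((e : ℝ) : ℂ) • (1 : Matrix n n ℂ) := by rw [hK'def, hKpdef, hH₀def]; abel
    rw [this]; exact gibbsWeight_sub_smul_one β e Kp
  have hZ'eq : Z' = Real.exp (β * e) * (P * gibbsWeight β Kp).trace.re := by
    rw [hZ'def, hshift, Matrix.mul_smul, trace_smul, smul_eq_mul, Complex.re_ofReal_mul]
  have hnum : (P * gibbsWeight β K' * -B).trace.re =
      -(g * (Real.exp (β * e) * (P * gibbsWeight β Kp * A).trace.re)) := by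
    rw [hshift, hBdef]
    simp only [Matrix.mul_neg, Matrix.mul_smul, Matrix.smul_mul, trace_neg, trace_smul, smul_eq_mul,
      Complex.neg_re, Complex.re_ofReal_mul]
  have hexp_pos : 0 < Real.exp (β * e) := Real.exp_pos _
  have hZKp : 0 < (P * gibbsWeight β Kp).trace.re := by
    have := hZ'pos; rw [hZ'eq] at this
    exact pos_of_mul_pos_right this hexp_pos.le
  -- floor in ratio form: `g m ≤ g · Re tr(P e^{-βKp} A) / Re tr(P e^{-βKp})`
  have hratio : g * m ≤ -((P * gibbsWeight β K' * -B).trace.re / Z') := by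
    rw [hnum, hZ'eq, neg_div, neg_neg]
    rw [le_div_iff₀ (mul_pos hexp_pos hZKp)]
    have hfl : m * (P * gibbsWeight β Kp).trace.re ≤ (P * gibbsWeight β Kp * A).trace.re := by
      rw [hKpdef, hBdef]; exact hfloor
    have := mul_le_mul_of_nonneg_left hfl (mul_nonneg hg hexp_pos.le)
    nlinarith [this]
  -- (3) logs: `log Z' + β g m ≤ log Re tr(P e^{-βH₀}) ≤ σ`
  have hlogpb : Real.log Z' + -(β * ((P * gibbsWeight β K' * -B).trace.re / Z')) ≤
      Real.log ((P * gibbsWeight β H₀).trace.re) := by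
    have hpos : 0 < Z' * Real.exp (-(β * ((P * gibbsWeight β K' * -B).trace.re / Z'))) :=
      mul_pos hZ'pos (Real.exp_pos _)
    have := Real.log_le_log hpos hpb
    rwa [Real.log_mul hZ'pos.ne' (Real.exp_pos _).ne', Real.log_exp] at this
  have hσ' : Real.log ((P * gibbsWeight β H₀).trace.re) ≤ σ := by rw [hH₀def]; exact hσ
  have hmain : Real.log Z' + β * (g * m) ≤ σ := by
    have : β * (g * m) ≤ -(β * ((P * gibbsWeight β K' * -B).trace.re / Z')) := by
      rw [← mul_neg]; exact mul_le_mul_of_nonneg_left hratio hβ.le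
    linarith
  -- `-(1/β) log Z' ≥ g m - σ/β`
  have hsm : g * m - σ / β ≤ -(1 / β) * Real.log Z' := by
    rw [show -(1 / β) * Real.log Z' = -(Real.log Z') / β by ring, sub_le_iff_le_add,
      show -Real.log Z' / β + σ / β = (σ - Real.log Z') / β by ring, le_div_iff₀ hβ]
    nlinarith
  exact hsm.trans hsoft

end Abstract

/-! ## The Hubbard torus at the isotropic schedule -/

section Hubbard

/-- **Every sector ground state inherits the penalised thermal floor — isotropic schedule with the
entropy dial.** At side `L`, coupling `U`, doping parameter `δ`: if the canonical
`(2⌊(1-δ)L²/2⌋, S^z = 0)` Gibbs state at `β = θL` of `K = hubbardTorus 2 L 1 U + (κ/L⁴)Δ_d†Δ_d` has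
`⟨Δ_d†Δ_d⟩ ≥ xL⁴` (real traces), the state count of the unpenalised `H` obeys
`log Re tr(P_S e^{-β(H - e_S)}) ≤ C·L/θ` (`e_S = minEnergyOn H S`), `κ, x, θ > 0` and `4C ≤ θ²κx`,
then every normalised sector ground state `ψ` has `(x/2)L⁴ ≤ Re⟨ψ, Δ_d†Δ_d ψ⟩`. [folklore] -/
theorem everyGroundState_of_isotropicFloorAt (L : ℕ) [NeZero L] (U δ κ x θ C : ℝ)
    (hκ : 0 < κ) (hx : 0 < x) (hθ : 0 < θ) (hC : 4 * C ≤ θ ^ 2 * κ * x)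
    (hfloor :
      x * (L : ℝ) ^ 4 *
          (projMatrix ((szSector (Λ := FermionTorus 2 L) (2 * ⌊(1 - δ) * (L : ℝ) ^ 2 / 2⌋₊) 0).map
              (Fock.toEuclidean (ι := Orb (FermionTorus 2 L)) :
                Fock (Orb (FermionTorus 2 L)) →ₗ[ℂ]
                  EuclideanSpace ℂ (Finset (Orb (FermionTorus 2 L))))) *
            gibbsWeight (θ * (L : ℝ)) (hubbardTorus 2 L 1 U +
              ((κ / (L : ℝ) ^ 4 : ℝ) : ℂ) •
                ((pairField dWaveFormFactor L)ᴴ * pairField dWaveFormFactor L))).trace.re ≤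
        (projMatrix ((szSector (Λ := FermionTorus 2 L) (2 * ⌊(1 - δ) * (L : ℝ) ^ 2 / 2⌋₊) 0).map
              (Fock.toEuclidean (ι := Orb (FermionTorus 2 L)) :
                Fock (Orb (FermionTorus 2 L)) →ₗ[ℂ]
                  EuclideanSpace ℂ (Finset (Orb (FermionTorus 2 L))))) *
            gibbsWeight (θ * (L : ℝ)) (hubbardTorus 2 L 1 U +
              ((κ / (L : ℝ) ^ 4 : ℝ) : ℂ) •
                ((pairField dWaveFormFactor L)ᴴ * pairField dWaveFormFactor L)) *
          ((pairField dWaveFormFactor L)ᴴ * pairField dWaveFormFactor L)).trace.re)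
    (hdial :
      Real.log ((projMatrix ((szSector (Λ := FermionTorus 2 L)
            (2 * ⌊(1 - δ) * (L : ℝ) ^ 2 / 2⌋₊) 0).map
              (Fock.toEuclidean (ι := Orb (FermionTorus 2 L)) :
                Fock (Orb (FermionTorus 2 L)) →ₗ[ℂ]
                  EuclideanSpace ℂ (Finset (Orb (FermionTorus 2 L))))) *
          gibbsWeight (θ * (L : ℝ)) (hubbardTorus 2 L 1 U -
            ((((hubbardTorus 2 L 1 U).minEnergyOn
              (szSector (Λ := FermionTorus 2 L) (2 * ⌊(1 - δ) * (L : ℝ) ^ 2 / 2⌋₊) 0) : ℝ) : ℂ) •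
              (1 : Matrix (Finset (Orb (FermionTorus 2 L))) (Finset (Orb (FermionTorus 2 L))) ℂ)))).trace.re) ≤
        C * (L : ℝ) / θ) :
    ∀ ψ : Fock (Orb (FermionTorus 2 L)),
      IsGroundStateInSector (hubbardTorus 2 L 1 U) (2 * ⌊(1 - δ) * (L : ℝ) ^ 2 / 2⌋₊) 0 ψ →
      star ψ ⬝ᵥ ψ = 1 →
      x / 2 * (L : ℝ) ^ 4 ≤
        (star ψ ⬝ᵥ ((pairField dWaveFormFactor L)ᴴ * pairField dWaveFormFactor L) *ᵥ ψ).re := by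
  intro ψ hgs h1
  set m : ℕ := ⌊(1 - δ) * (L : ℝ) ^ 2 / 2⌋₊ with hmdef
  set H := hubbardTorus 2 L 1 U with hHdef
  set S := szSector (Λ := FermionTorus 2 L) (2 * m) 0 with hSdef
  set A := (pairField dWaveFormFactor L)ᴴ * pairField dWaveFormFactor L with hAdef
  set e : ℝ := H.minEnergyOn S with hedef
  have hL : (0 : ℝ) < (L : ℝ) := by exact_mod_cast Nat.pos_of_ne_zero (NeZero.ne L)
  have hL4 : (0 : ℝ) < (L : ℝ) ^ 4 := by positivity
  have hβ : 0 < θ * (L : ℝ) := mul_pos hθ hL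
  have hg : 0 ≤ κ / (L : ℝ) ^ 4 := (div_pos hκ hL4).le
  have hH : H.IsHermitian := LiebThm1.hamiltonian_isHermitian (fermionTorusGraph 2 L) 1 U
  have hA : A.IsHermitian := Matrix.isHermitian_conjTranspose_mul_self _
  have hSH : ∀ v ∈ S, H *ᵥ v ∈ S := fun v hv => hubbardTorus_mulVec_mem_szSector 2 L 1 U m hv
  have hSA : ∀ v ∈ S, A *ᵥ v ∈ S := fun v hv => pairPenalty_mulVec_mem_szSector L m hv
  obtain ⟨hψS, hψ0, hHψ⟩ := hgs
  have hS0 : S ≠ ⊥ := by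
    rw [Submodule.ne_bot_iff]; exact ⟨ψ, hψS, hψ0⟩
  -- the entropy-priced abstract chain
  have hchain := softmin_chain_entropic S hS0 hH hA hSH hSA hβ hg (x * (L : ℝ) ^ 4) e
    (C * (L : ℝ) / θ) ψ hψS h1 hHψ hfloor hdial
  -- arithmetic: `κ x - C/θ² ≤ (κ/L⁴) ⟨A⟩` and `C/θ² ≤ κ x/4`
  have hk : κ / (L : ℝ) ^ 4 * (x * (L : ℝ) ^ 4) = κ * x := by field_simp
  have hent : C * (L : ℝ) / θ / (θ * (L : ℝ)) = C / θ ^ 2 := by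
    field_simp
  rw [hk, hent] at hchain
  have hθ2 : 0 < θ ^ 2 := by positivity
  have hbudget : C / θ ^ 2 ≤ κ * x / 4 := by
    rw [div_le_div_iff₀ hθ2 (by norm_num : (0:ℝ) < 4)]
    linarith
  have hfinal : 3 / 4 * (κ * x) ≤ κ / (L : ℝ) ^ 4 * (star ψ ⬝ᵥ (A *ᵥ ψ)).re := by linarith
  have hq : x / 2 * (L : ℝ) ^ 4 ≤ 3 / 4 * x * (L : ℝ) ^ 4 := by nlinarith
  refine hq.trans ?_
  have h3 : 3 / 4 * x * (L : ℝ) ^ 4 = (3 / 4 * (κ * x)) / (κ / (L : ℝ) ^ 4) := by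
    field_simp
  rw [h3, div_le_iff₀ (div_pos hκ hL4)]
  linarith

/-- STUB of line `Sketch` (lead-held). **Transfer (R2, isotropic schedule with the entropy dial)**:
the penalised thermal floor at `β_L = θL` together with the state count
`log Re tr(P_S e^{-β_L(H - e_S)}) ≤ C·L/θ`, `θ > 0`, `4C ≤ θ²κx`, on a window of couplings and
eventually in even `L`, implies the crux with `c = x/2`. [folklore] -/
theorem stub_transferIsotropic (δ U₁ U₂ κ x θ C : ℝ) (hδ : δ ∈ Set.Ioo (0 : ℝ) (1 / 2))
    (hU₁ : 0 < U₁) (hU₁₂ : U₁ < U₂) (hκ : 0 < κ) (hx : 0 < x) (hθ : 0 < θ)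
    (hC : 4 * C ≤ θ ^ 2 * κ * x)
    (h : ∀ U ∈ Set.Ioo U₁ U₂, ∃ L₀ : ℕ, ∀ (L : ℕ) [NeZero L], L₀ ≤ L → Even L →
      let N : ℕ := 2 * ⌊(1 - δ) * (L : ℝ) ^ 2 / 2⌋₊
      let H := hubbardTorus 2 L 1 U
      let S := szSector (Λ := FermionTorus 2 L) N 0
      let P := projMatrix (S.map (Fock.toEuclidean (ι := Orb (FermionTorus 2 L)) :
        Fock (Orb (FermionTorus 2 L)) →ₗ[ℂ] EuclideanSpace ℂ (Finset (Orb (FermionTorus 2 L)))))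
      let A := (pairField dWaveFormFactor L)ᴴ * pairField dWaveFormFactor L
      let K := H + ((κ / (L : ℝ) ^ 4 : ℝ) : ℂ) • A
      let β : ℝ := θ * (L : ℝ)
      let e : ℝ := H.minEnergyOn S
      x * (L : ℝ) ^ 4 * (P * gibbsWeight β K).trace.re ≤ (P * gibbsWeight β K * A).trace.re ∧
        Real.log ((P * gibbsWeight β (H - ((e : ℝ) : ℂ) • 1)).trace.re) ≤ C * (L : ℝ) / θ) :
    BirGroundStateAverageLRO := by
  refine birGroundStateAverageLRO_of_forall_groundState
    ⟨δ, hδ, U₁, U₂, x / 2, hU₁, hU₁₂, by positivity, fun U hU => ?_⟩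
  obtain ⟨L₀, hL₀⟩ := h U hU
  refine ⟨L₀, fun L _ hL hLe => ?_⟩
  obtain ⟨hfl, hdl⟩ := hL₀ L hL hLe
  exact everyGroundState_of_isotropicFloorAt L U δ κ x θ C hκ hx hθ hC hfl hdl

/-- **Transfer (R2, isotropic schedule with the entropy dial)** — alias of the registered stub
`stub_transferIsotropic`. [folklore] -/
theorem transfer_isotropic (δ U₁ U₂ κ x θ C : ℝ) (hδ : δ ∈ Set.Ioo (0 : ℝ) (1 / 2))
    (hU₁ : 0 < U₁) (hU₁₂ : U₁ < U₂) (hκ : 0 < κ) (hx : 0 < x) (hθ : 0 < θ)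
    (hC : 4 * C ≤ θ ^ 2 * κ * x)
    (h : ∀ U ∈ Set.Ioo U₁ U₂, ∃ L₀ : ℕ, ∀ (L : ℕ) [NeZero L], L₀ ≤ L → Even L →
      let N : ℕ := 2 * ⌊(1 - δ) * (L : ℝ) ^ 2 / 2⌋₊
      let H := hubbardTorus 2 L 1 U
      let S := szSector (Λ := FermionTorus 2 L) N 0
      let P := projMatrix (S.map (Fock.toEuclidean (ι := Orb (FermionTorus 2 L)) :
        Fock (Orb (FermionTorus 2 L)) →ₗ[ℂ] EuclideanSpace ℂ (Finset (Orb (FermionTorus 2 L)))))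
      let A := (pairField dWaveFormFactor L)ᴴ * pairField dWaveFormFactor L
      let K := H + ((κ / (L : ℝ) ^ 4 : ℝ) : ℂ) • A
      let β : ℝ := θ * (L : ℝ)
      let e : ℝ := H.minEnergyOn S
      x * (L : ℝ) ^ 4 * (P * gibbsWeight β K).trace.re ≤ (P * gibbsWeight β K * A).trace.re ∧
        Real.log ((P * gibbsWeight β (H - ((e : ℝ) : ℂ) • 1)).trace.re) ≤ C * (L : ℝ) / θ) :
    BirGroundStateAverageLRO :=
  stub_transferIsotropic δ U₁ U₂ κ x θ C hδ hU₁ hU₁₂ hκ hx hθ hC h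

end Hubbard

end Summit.HubbardSuperconductivity.HubbardSuperconductivity.Theorems.BirGroundStateAverageLRO.Softmin
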